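import Literature.MathematicalPhysics.QuantumLattice.GroundStateDensityMatrixSupport
import Literature.MathematicalPhysics.QuantumLattice.GroundStateSectorGapModeBound
import Literature.MathematicalPhysics.QuantumLattice.PairFieldMomentum
import Literature.MathematicalPhysics.QuantumLattice.PairCorrelationsProofs
import HarnessLib

/-!
# The `k = 0` step of Kennedy–Lieb–Shastry in certified-input form: sum rule + ceilings at `k ≠ 0`
# give a floor at `k = 0`

Topic `MathematicalPhysics/QuantumLattice` (family `hubbard`; cell `hubbard-cq`, LADDER row PC-b "infrared-
bound analogue"). Companion and ASSEMBLY step of `GroundStateInfraredBoundEveryState.lean`,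
`GroundStateDensityMatrixSupport.lean` (the Gaussian-domination MODE CEILING `Re tr(ρV²) ≤ ½√(QD)` in
every ground-state density matrix) and `GroundStateSectorGapModeBound.lean` (the SPECTRAL mode ceiling
`Re tr(ρ(A†A + AA†)) ≤ D/ω`): those files bound ONE mode `k ≠ 0`; this file does the model-free
bookkeeping that turns a SUM RULE over all modes plus ceilings at every `k ≠ k₀` into a FLOOR at `k₀`
(Kennedy–Lieb–Shastry, J. Stat. Phys. 53 (1988) 1019, eqs. (6)–(9); PRL 61 (1988) 2582, p. 2583:
"`g_0 ≥ (sum rule) - Σ_{p ≠ 0} (infrared bound)_p`"), in three strengths: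

* PLAIN (`sub_sum_erase_le_of_sumRule_of_ceilings`): `Φ ≤ Σ_k S_k`, `S_k ≤ B_k (k ≠ k₀)` ⇒
  `Φ - Σ_{k ≠ k₀} B_k ≤ S_{k₀}`.
* KERNEL (`sub_sum_erase_le_kernel_mul_of_ceilings`): a weighted ("dictionary") sum rule
  `Φ ≤ Σ_k w_k S_k` with `S ≥ 0` ⇒ `Φ - Σ_{k ≠ k₀} w_k⁺ B_k ≤ w_{k₀} S_{k₀}` — ceilings are paid only where
  the kernel is positive (KLS's trial-kernel device, tree `klsKernel` / `kls_heis_kernelSumRule` for the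
  Heisenberg antiferromagnet).
* LP-DUAL WITH CERTIFIED WINDOW ROWS (`lpDual_kernel_floor`, `lpDual_kernel_floor_div`): finitely many
  two-sided rows `|Σ_k a_{rk} S_k - c_r| ≤ ε_r` (certified correlation data) and ANY real multipliers `λ_r`
  give `Σ_r (λ_r c_r - |λ_r| ε_r) - Σ_{k ≠ k₀} (Σ_r λ_r a_{rk})⁺ B_k ≤ (Σ_r λ_r a_{rk₀}) S_{k₀}`. The vector `λ`
  is the CERTIFICATE (the dual solution of the "dictionary infrared LP"); Lean checks weak duality only.

Then the compositions and the concrete pair-field forms: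

* `trace_sq_ge_of_sumRule_of_gaussianDomination` — every ground-state density matrix `ρ`, Hermitian mode
  family `V_k`, Gaussian-domination constants `Q_k` and double-commutator ceilings `D_k` at `k ≠ k₀`:
  `Φ - Σ_{k ≠ k₀} ½√(Q_k D_k) ≤ Re tr(ρ V_{k₀}²)`.
* `trace_conjTranspose_mul_ge_of_sumRule_of_sectorGaps` — the same with the SPECTRAL inputs (sector gaps
  `ω_k`, any mode family `A_k`): `Φ - Σ_{k ≠ k₀} D_k/ω_k ≤ Re tr(ρ A_{k₀}†A_{k₀})`.
* Pair field on the fermionic torus `(ℤ/Lℤ)²` (`pairFieldAt`, `pairStructureFactor` of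
  `PairFieldMomentum.lean`): the SHIFTED operator Plancherel
  `Σ_m χ_m(z) A(m)ᴴA(m) = L^d Σ_x A_xᴴ A_{x+z}` (`sum_torusChar_smul_conjTranspose_mul_fourierMode`, any `d`,
  any operator family) and the DICTIONARY SUM RULE `Σ_m Re χ_m(z) S_ψ(m) = Re Σ_x ⟨P_x ψ, P_{x+z} ψ⟩`
  (`sum_re_torusChar_mul_pairStructureFactor`; `z = 0` is the tree's `sum_pairStructureFactor`); the floors
  `pairStructureFactor_zero_ge_of_onSite_floor_of_ceilings` (plain), `pairFieldLRO_ge_of_onSite_floor_of_ceilings`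
  (normalisation `L⁻⁴ Re⟨Δ†Δ⟩` of `hasPairFieldLRO_iff_liminf`), `kernel_pairStructureFactor_zero_floor`
  (LP-dual with a window `W` of certified summed pair correlations), and the thermodynamic-limit consumer
  `hasPairFieldLRO_of_eventually_onSite_floor_of_ceilings` (eventual on-site floor `c`, eventual ceilings with
  tail `Σ_{m ≠ 0} B_m ≤ βL²`, `β < c` ⇒ `HasPairFieldLRO`).

HONEST FRAMING (cell hubbard-cq, START-HERE §8 census (10), critic-2 TOOLKIT K1′). Everything here is a
TOOL, unconditional as arithmetic and CONDITIONAL as an instrument: the `k ≠ 0` inputs (`Q_k`: a Gaussian-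
domination substitute, structurally invisible to certified sourced energy windows; or `ω_k`: a certified
sector/yrast gap) are NOT asserted for any model. Sizing of record [float arithmetic on print]: a KLS-shape
closure is non-vacuous only if the summed relative slack of the `k ≠ 0` ceilings is below the condensate
share `S(0)/(N p_d)`; at the cuprate anchors `(U, n, t′) = (8, 7/8, 0 or -1/4)` that share is
`≤ 16Δ²/p_d(0,0) ≤ 4.6e-3/0.126 ≈ 3.7 %` (Xu et al. 2024 print over the certified on-site floor), versus
`30–60 %` in the models where KLS/DLS closes — so this chain cannot certify PRESENT there even with exact
moments. Calibration of the LP-dual form where an infrared bound DOES hold [float, kit job j255957, linear-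
spin-wave proxy correlators, `L = 64`]: spin-½ easy-plane XXZ `-(SˣSˣ+SʸSʸ) + u SᶻSᶻ`, window = shifts of
`ℓ∞`-range `R` certified to `±ε`: `u = 0`: floor `0.051` (R = 1, the classic nearest-neighbour kernel) →
`0.091` (R = 8) against the proxy order `m²/2 = 0.097`; `u = 0.9`, `ε = 10⁻³`: `0.019` (R = 2) → `0.054`
(R = 8) vs `0.065`; `u = 1` (Heisenberg point), `ε = 3·10⁻³`: `0` (R = 2) → `0.032` (R = 8) vs `0.046`.

No definition and no named fact is introduced; every declaration is a proved theorem.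

## References
* T. Kennedy, E. H. Lieb, B. S. Shastry, J. Stat. Phys. 53 (1988) 1019–1030 [KLS1988JSP], eqs. (1)–(3),
  (6)–(9) (sum rule, infrared bound, the `q = Q` split and the trial kernel).
* T. Kennedy, E. H. Lieb, B. S. Shastry, Phys. Rev. Lett. 61 (1988) 2582–2584 [KLS1988PRL], pp. 2582–2583
  (Fourier modes of the order operator, Parseval sum rule, `g_0 ≥ … > 0`).
* F. J. Dyson, E. H. Lieb, B. Simon, J. Stat. Phys. 18 (1978) 335–383 [DLS1978], Thm. 4.2 and §5 (the
  same bookkeeping at `T > 0`).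
* S. Friedli, Y. Velenik, *Statistical Mechanics of Lattice Systems* (2017), §10.4 [FriedliVelenik2017]
  (Fourier analysis on `(ℤ/Lℤ)^d`).
* D. J. Scalapino, Phys. Rep. 250 (1995) 329, §2 [Scalapino1995] (the `d`-wave pair field and its
  equal-time correlations).
-/

noncomputable section

open Matrix Finset Filter Topology
open scoped ComplexOrder ComplexConjugate
open Literature.Barriers.HubbardSuperconductivity (IsDensityMatrix IsGroundStateDensityMatrix)
open Literature.Probability.LatticeModels

namespace Literature.MathematicalPhysics.QuantumLattice

open HubbardWave0

/-! ### The abstract `k = 0` bookkeeping -/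

section Bookkeeping

variable {K : Type*} [Fintype K] [DecidableEq K]

/-- **Sum rule + ceilings off `k₀` ⇒ floor at `k₀`** (Kennedy–Lieb–Shastry's `q = Q` split, model-free):
if `Φ ≤ Σ_k S_k` and `S_k ≤ B_k` for every `k ≠ k₀`, then `Φ - Σ_{k ≠ k₀} B_k ≤ S_{k₀}`.
[cite: KLS1988JSP, eqs. (6)-(9)] [cite: KLS1988PRL, p. 2583] -/
theorem sub_sum_erase_le_of_sumRule_of_ceilings (S B : K → ℝ) (k₀ : K) {Φ : ℝ}
    (hsum : Φ ≤ ∑ k, S k) (hceil : ∀ k, k ≠ k₀ → S k ≤ B k) :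
    Φ - ∑ k ∈ (univ : Finset K).erase k₀, B k ≤ S k₀ := by
  have h1 : ∑ k ∈ (univ : Finset K).erase k₀, S k ≤ ∑ k ∈ (univ : Finset K).erase k₀, B k :=
    Finset.sum_le_sum fun k hk => hceil k (Finset.ne_of_mem_erase hk)
  have h2 := Finset.add_sum_erase (univ : Finset K) S (Finset.mem_univ k₀)
  linarith

/-- **Kernel (dictionary) form.** If `S ≥ 0`, `Φ ≤ Σ_k w_k S_k` for a real kernel `w`, and `S_k ≤ B_k` for
`k ≠ k₀`, then `Φ - Σ_{k ≠ k₀} w_k⁺ B_k ≤ w_{k₀} S_{k₀}` (`w⁺ = max(w, 0)`): the ceilings are paid only where the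
kernel is positive, the negative part is dropped by `S ≥ 0` — the trial-kernel device of Kennedy–Lieb–Shastry.
[cite: KLS1988JSP, eqs. (6)-(9)] -/
theorem sub_sum_erase_le_kernel_mul_of_ceilings (S B w : K → ℝ) (k₀ : K) {Φ : ℝ}
    (hS : ∀ k, 0 ≤ S k) (hrow : Φ ≤ ∑ k, w k * S k) (hceil : ∀ k, k ≠ k₀ → S k ≤ B k) :
    Φ - ∑ k ∈ (univ : Finset K).erase k₀, max (w k) 0 * B k ≤ w k₀ * S k₀ := by
  have h1 : ∀ k ∈ (univ : Finset K).erase k₀, w k * S k ≤ max (w k) 0 * B k := by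
    intro k hk
    calc w k * S k ≤ max (w k) 0 * S k := mul_le_mul_of_nonneg_right (le_max_left _ _) (hS k)
      _ ≤ max (w k) 0 * B k :=
          mul_le_mul_of_nonneg_left (hceil k (Finset.ne_of_mem_erase hk)) (le_max_right _ _)
  have h2 := Finset.sum_le_sum h1
  have h3 := Finset.add_sum_erase (univ : Finset K) (fun k => w k * S k) (Finset.mem_univ k₀)
  linarith

/-- **LP-dual form with certified window rows** (weak duality of the dictionary infrared LP). Data: a
nonnegative mode function `S`, finitely many certified two-sided rows `|Σ_k a_{rk} S_k - c_r| ≤ ε_r`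
(`r ∈ R`), ceilings `S_k ≤ B_k` off `k₀`. Certificate: ANY real multipliers `λ_r`. Conclusion:
`Σ_r (λ_r c_r - |λ_r| ε_r) - Σ_{k ≠ k₀} (Σ_r λ_r a_{rk})⁺ B_k ≤ (Σ_r λ_r a_{rk₀}) S_{k₀}`.
(The optimal `λ` is found by an LP solver outside Lean; only this inequality is checked.)
[cite: KLS1988JSP, eqs. (6)-(9)] -/
theorem lpDual_kernel_floor {ρ : Type*} (R : Finset ρ) (a : ρ → K → ℝ) (c ε lam : ρ → ℝ)
    (S B : K → ℝ) (k₀ : K) (hS : ∀ k, 0 ≤ S k)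
    (hrow : ∀ r ∈ R, |∑ k, a r k * S k - c r| ≤ ε r) (hceil : ∀ k, k ≠ k₀ → S k ≤ B k) :
    ∑ r ∈ R, (lam r * c r - |lam r| * ε r) -
        ∑ k ∈ (univ : Finset K).erase k₀, max (∑ r ∈ R, lam r * a r k) 0 * B k ≤
      (∑ r ∈ R, lam r * a r k₀) * S k₀ := by
  have h1 : ∀ r ∈ R, lam r * c r - |lam r| * ε r ≤ lam r * ∑ k, a r k * S k := by
    intro r hr
    have h4 : |lam r * (∑ k, a r k * S k - c r)| ≤ |lam r| * ε r := by
      rw [abs_mul]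
      exact mul_le_mul_of_nonneg_left (hrow r hr) (abs_nonneg _)
    have h5 := neg_abs_le (lam r * (∑ k, a r k * S k - c r))
    nlinarith [h4, h5]
  have h2 : ∑ r ∈ R, (lam r * c r - |lam r| * ε r) ≤ ∑ r ∈ R, lam r * ∑ k, a r k * S k :=
    Finset.sum_le_sum h1
  have h3 : ∑ r ∈ R, lam r * ∑ k, a r k * S k = ∑ k, (∑ r ∈ R, lam r * a r k) * S k := by
    simp_rw [Finset.mul_sum, Finset.sum_mul]
    rw [Finset.sum_comm]
    refine Finset.sum_congr rfl fun k _ => Finset.sum_congr rfl fun r _ => ?_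
    ring
  exact sub_sum_erase_le_kernel_mul_of_ceilings S B (fun k => ∑ r ∈ R, lam r * a r k) k₀ hS
    (h2.trans h3.le) hceil

/-- **LP-dual form, divided**: if moreover the kernel is positive at `k₀`, `0 < Σ_r λ_r a_{rk₀}`, then
`S_{k₀} ≥ (Σ_r (λ_r c_r - |λ_r| ε_r) - Σ_{k ≠ k₀} (Σ_r λ_r a_{rk})⁺ B_k) / (Σ_r λ_r a_{rk₀})`.
[cite: KLS1988JSP, eqs. (6)-(9)] -/
theorem lpDual_kernel_floor_div {ρ : Type*} (R : Finset ρ) (a : ρ → K → ℝ) (c ε lam : ρ → ℝ)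
    (S B : K → ℝ) (k₀ : K) (hS : ∀ k, 0 ≤ S k)
    (hrow : ∀ r ∈ R, |∑ k, a r k * S k - c r| ≤ ε r) (hceil : ∀ k, k ≠ k₀ → S k ≤ B k)
    (hpos : 0 < ∑ r ∈ R, lam r * a r k₀) :
    (∑ r ∈ R, (lam r * c r - |lam r| * ε r) -
        ∑ k ∈ (univ : Finset K).erase k₀, max (∑ r ∈ R, lam r * a r k) 0 * B k) /
        (∑ r ∈ R, lam r * a r k₀) ≤ S k₀ := by
  rw [div_le_iff₀ hpos, mul_comm]
  exact lpDual_kernel_floor R a c ε lam S B k₀ hS hrow hceil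

end Bookkeeping

/-! ### Composition with the mode ceilings in every ground state -/

section EveryGroundState

variable {K : Type*} [Fintype K] [DecidableEq K]
variable {n : Type*} [Fintype n] [DecidableEq n]

/-- **Floor at `k₀` from Gaussian domination off `k₀`, every ground-state density matrix.** For a Hermitian
`H`, a ground-state density matrix `ρ` of `H`, a Hermitian mode family `V_k`, a sum rule
`Φ ≤ Σ_k Re tr(ρV_k²)`, and, at every `k ≠ k₀`, a Gaussian-domination-type energy bound
`E₀(H) ≤ E₀(H + tV_k + ½t²Q_k)` (all real `t`, `Q_k ≥ 0`) with a double-commutator ceiling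
`Re tr(ρ[V_k,[H,V_k]]) ≤ D_k`: `Φ - Σ_{k ≠ k₀} ½√(Q_k D_k) ≤ Re tr(ρV_{k₀}²)` — the Kennedy–Lieb–Shastry
long-range-order bound in certified-input form (`trace_sq_le_half_sqrt_of_isGroundStateDensityMatrix` summed).
CONDITIONAL as an instrument: the `Q_k` are inputs, asserted for no model here.
[cite: KLS1988JSP, eqs. (6)-(9), (12)-(14)] -/
theorem trace_sq_ge_of_sumRule_of_gaussianDomination [Nonempty n] {H ρ : Matrix n n ℂ}
    (hH : H.IsHermitian) (hρ : IsGroundStateDensityMatrix H ρ)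
    (V : K → Matrix n n ℂ) (hV : ∀ k, (V k).IsHermitian) (k₀ : K) (Q D : K → ℝ) {Φ : ℝ}
    (hsum : Φ ≤ ∑ k, (ρ * (V k * V k)).trace.re)
    (hQ : ∀ k, k ≠ k₀ → 0 ≤ Q k)
    (hGD : ∀ k, k ≠ k₀ → ∀ t : ℝ, H.groundEnergy ≤
      (H + (t : ℂ) • V k + ((t ^ 2 * Q k / 2 : ℝ) : ℂ) • (1 : Matrix n n ℂ)).groundEnergy)
    (hD : ∀ k, k ≠ k₀ →
      (ρ * (V k * (H * V k - V k * H) - (H * V k - V k * H) * V k)).trace.re ≤ D k) :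
    Φ - ∑ k ∈ (univ : Finset K).erase k₀, Real.sqrt (Q k * D k) / 2 ≤
      (ρ * (V k₀ * V k₀)).trace.re :=
  sub_sum_erase_le_of_sumRule_of_ceilings (fun k => (ρ * (V k * V k)).trace.re)
    (fun k => Real.sqrt (Q k * D k) / 2) k₀ hsum fun k hk =>
    trace_sq_le_half_sqrt_of_isGroundStateDensityMatrix hH (hV k) hρ (hQ k hk) (hGD k hk) (hD k hk)

/-- `Re tr(ρA†A) ≤ Re tr(ρ(A†A + AA†))` for `ρ ⪰ 0` (the dropped term `Re tr(ρAA†)` is nonnegative). [folklore] -/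
private theorem re_trace_conjTranspose_mul_le_re_trace_anticommutator {ρ : Matrix n n ℂ} (hρ : ρ.PosSemidef)
    (A : Matrix n n ℂ) :
    (ρ * (Aᴴ * A)).trace.re ≤ (ρ * (Aᴴ * A + A * Aᴴ)).trace.re := by
  have h : 0 ≤ (ρ * (A * Aᴴ)).trace.re :=
    Literature.LinearAlgebra.Matrix.re_trace_mul_nonneg_of_posSemidef hρ
      (posSemidef_self_mul_conjTranspose A)
  rw [mul_add, trace_add, Complex.add_re]
  linarith

/-- **Floor at `k₀` from sector gaps off `k₀`, every ground-supported state** (the SPECTRAL route,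
`trace_le_div_of_sectorGaps` summed). For `ρ ⪰ 0` with `Hρ = E₀ρ`, any mode family `A_k`, a sum rule
`Φ ≤ Σ_k Re tr(ρA_k†A_k)`, and at every `k ≠ k₀`: range projections `P_k (A_kρ) = A_kρ`,
`P'_k (A_k†ρ) = A_k†ρ` with sector gaps `P_k†(H - E₀ - ω_k)P_k ⪰ 0`, `P'_k†(H - E₀ - ω_k)P'_k ⪰ 0`, `ω_k > 0`,
and `Re tr(ρ[A_k†,[H,A_k]]) ≤ D_k`: `Φ - Σ_{k ≠ k₀} D_k/ω_k ≤ Re tr(ρA_{k₀}†A_{k₀})`.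
CONDITIONAL as an instrument: the gaps `ω_k` are inputs (card `yrast-landau-ir-step`), asserted for no model.
[cite: KLS1988PRL, p. 2583] [cite: Feynman1954, §III] -/
theorem trace_conjTranspose_mul_ge_of_sumRule_of_sectorGaps {H ρ : Matrix n n ℂ}
    (hH : H.IsHermitian) (hρ : ρ.PosSemidef) (hHρ : H * ρ = (H.groundEnergy : ℂ) • ρ)
    (A P P' : K → Matrix n n ℂ) (ω D : K → ℝ) (k₀ : K) {Φ : ℝ}
    (hsum : Φ ≤ ∑ k, (ρ * ((A k)ᴴ * A k)).trace.re)
    (hPA : ∀ k, k ≠ k₀ → P k * (A k * ρ) = A k * ρ)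
    (hP'A : ∀ k, k ≠ k₀ → P' k * ((A k)ᴴ * ρ) = (A k)ᴴ * ρ)
    (hω : ∀ k, k ≠ k₀ → 0 < ω k)
    (hgap : ∀ k, k ≠ k₀ →
      ((P k)ᴴ * (H - ((H.groundEnergy + ω k : ℝ) : ℂ) • 1) * P k).PosSemidef)
    (hgap' : ∀ k, k ≠ k₀ →
      ((P' k)ᴴ * (H - ((H.groundEnergy + ω k : ℝ) : ℂ) • 1) * P' k).PosSemidef)
    (hD : ∀ k, k ≠ k₀ →
      (ρ * ((A k)ᴴ * (H * A k - A k * H) - (H * A k - A k * H) * (A k)ᴴ)).trace.re ≤ D k) :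
    Φ - ∑ k ∈ (univ : Finset K).erase k₀, D k / ω k ≤ (ρ * ((A k₀)ᴴ * A k₀)).trace.re := by
  refine sub_sum_erase_le_of_sumRule_of_ceilings (fun k => (ρ * ((A k)ᴴ * A k)).trace.re)
    (fun k => D k / ω k) k₀ hsum fun k hk => ?_
  exact (re_trace_conjTranspose_mul_le_re_trace_anticommutator hρ (A k)).trans
    (trace_le_div_of_sectorGaps hH hρ hHρ (hPA k hk) (hP'A k hk) (hω k hk) (hgap k hk) (hgap' k hk)
      (hD k hk))

end EveryGroundState

/-! ### The shifted operator Plancherel and the dictionary sum rule for the pair field -/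

section ShiftedPlancherel

variable {d L : ℕ} [NeZero L]

/-- **Shifted Plancherel for operator-valued Fourier modes on `(ℤ/Lℤ)^d`.** For any family `A_x` of square
complex matrices and `A(m) := Σ_x conj χ_m(x) • A_x`, every shift `z` satisfies
`Σ_m χ_m(z) • A(m)ᴴ A(m) = L^d • Σ_x A_xᴴ A_{x+z}` (character orthogonality `Σ_m χ_m(w) = L^d δ_{w,0}`);
`z = 0` is `sum_conjTranspose_mul_fourierMode`. This is the operator form of the correlation DICTIONARY
`|Λ|⁻¹ Σ_q ĝ_q cos(q·z) = c(z)` behind Kennedy–Lieb–Shastry's trial kernels.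
[cite: KLS1988JSP, eqs. (2)-(3)] [cite: FriedliVelenik2017, §10.4] -/
theorem sum_torusChar_smul_conjTranspose_mul_fourierMode {n : Type*} [Fintype n]
    (A : TorusSite d L → Matrix n n ℂ) (z : TorusSite d L) :
    ∑ m : TorusSite d L, torusChar m z •
        ((∑ x, conj (torusChar m x) • A x)ᴴ * (∑ y, conj (torusChar m y) • A y)) =
      ((L : ℂ) ^ d) • ∑ x, (A x)ᴴ * A (x + z) := by
  have hH : ∀ m : TorusSite d L,
      (∑ x, conj (torusChar m x) • A x)ᴴ = ∑ x, torusChar m x • (A x)ᴴ := by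
    intro m
    simp only [conjTranspose_sum, conjTranspose_smul, starRingEnd_apply, star_star]
  have hm : ∀ m : TorusSite d L,
      torusChar m z • ((∑ x, torusChar m x • (A x)ᴴ) * (∑ y, conj (torusChar m y) • A y)) =
        ∑ x, ∑ y, torusChar m (z + (x - y)) • ((A x)ᴴ * A y) := by
    intro m
    rw [Finset.sum_mul_sum, Finset.smul_sum]
    refine Finset.sum_congr rfl fun x _ => ?_
    rw [Finset.smul_sum]
    refine Finset.sum_congr rfl fun y _ => ?_
    rw [smul_mul_assoc, mul_smul_comm, smul_smul, smul_smul, mul_assoc, ← torusChar_sub_right,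
      ← torusChar_add_right]
  simp_rw [hH, hm]
  rw [Finset.sum_comm, Finset.smul_sum]
  refine Finset.sum_congr rfl fun x _ => ?_
  rw [Finset.sum_comm]
  simp_rw [← Finset.sum_smul, sum_torusChar_left]
  have hiff : ∀ y : TorusSite d L, (z + (x - y) = 0) ↔ (x + z = y) := fun y => by
    rw [add_sub, sub_eq_zero, add_comm]
  simp_rw [hiff, ite_smul, zero_smul]
  rw [Finset.sum_ite_eq, if_pos (Finset.mem_univ _)]

end ShiftedPlancherel

section PairField

variable (g : Site 2 → ℝ) (L : ℕ) [NeZero L]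

/-- **Shifted Plancherel for the pair field**: `Σ_m χ_m(z) • Δ_g(m)ᴴ Δ_g(m) = L² • Σ_x P_xᴴ P_{x+z}`
(`P_x = localPair g L x`, `Δ_g(m) = pairFieldAt g L m`). [cite: KLS1988PRL, p. 2582] -/
theorem sum_torusChar_smul_conjTranspose_pairFieldAt_mul (z : TorusSite 2 L) :
    ∑ m, torusChar m z • ((pairFieldAt g L m)ᴴ * pairFieldAt g L m) =
      ((L : ℂ) ^ 2) • ∑ x, (localPair g L x)ᴴ * localPair g L (x + z) := by
  simp_rw [pairFieldAt_eq_sum_torusChar]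
  exact sum_torusChar_smul_conjTranspose_mul_fourierMode (localPair g L) z

/-- **Dictionary sum rule, vector form**: `Σ_m χ_m(z) ‖Δ_g(m)ψ‖² = L² Σ_x ⟨P_x ψ, P_{x+z} ψ⟩`
(in `dotProduct` form). [cite: KLS1988PRL, p. 2582] -/
theorem sum_torusChar_mul_star_pairFieldAt_mulVec_dotProduct (ψ : Fock (Orb (FermionTorus 2 L)))
    (z : TorusSite 2 L) :
    ∑ m, torusChar m z * (star (pairFieldAt g L m *ᵥ ψ) ⬝ᵥ (pairFieldAt g L m *ᵥ ψ)) =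
      (L : ℂ) ^ 2 * ∑ x, star (localPair g L x *ᵥ ψ) ⬝ᵥ (localPair g L (x + z) *ᵥ ψ) := by
  have h := congrArg (fun T => star ψ ⬝ᵥ (T *ᵥ ψ))
    (sum_torusChar_smul_conjTranspose_pairFieldAt_mul g L z)
  simp only [sum_mulVec, dotProduct_sum, smul_mulVec, dotProduct_smul, smul_eq_mul] at h
  simp_rw [star_mulVec_dotProduct_mulVec]
  exact h

/-- **Dictionary sum rule for the pair structure factor**: for every Fock vector `ψ` and every shift `z`,
`Σ_m Re χ_m(z) · S_ψ(m) = Re Σ_x ⟨P_x ψ, P_{x+z} ψ⟩` (`Re χ_m(z) = cos(q_m·z)`, `torusChar_re`); `z = 0` is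
`sum_pairStructureFactor`. The right-hand side is `L²` times the site-AVERAGED pair correlation at shift
`z`, a reduced-density-matrix quantity. [cite: KLS1988JSP, eqs. (2)-(3)] [cite: KLS1988PRL, p. 2582] -/
theorem sum_re_torusChar_mul_pairStructureFactor (ψ : Fock (Orb (FermionTorus 2 L))) (z : TorusSite 2 L) :
    ∑ m, (torusChar m z).re * pairStructureFactor g L ψ m =
      (∑ x, star (localPair g L x *ᵥ ψ) ⬝ᵥ (localPair g L (x + z) *ᵥ ψ)).re := by
  have hL : (L : ℝ) ^ 2 ≠ 0 := pow_ne_zero _ (Nat.cast_ne_zero.2 (NeZero.ne L))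
  have him : ∀ m : TorusSite 2 L,
      (star (pairFieldAt g L m *ᵥ ψ) ⬝ᵥ (pairFieldAt g L m *ᵥ ψ)).im = 0 := fun m =>
    (Complex.nonneg_iff.1 (dotProduct_star_self_nonneg _)).2.symm
  have hterm : ∀ m : TorusSite 2 L, (torusChar m z).re * pairStructureFactor g L ψ m =
      (torusChar m z * (star (pairFieldAt g L m *ᵥ ψ) ⬝ᵥ (pairFieldAt g L m *ᵥ ψ))).re /
        (L : ℝ) ^ 2 := by
    intro m
    rw [pairStructureFactor_apply, Complex.mul_re, him, mul_zero, sub_zero, mul_div_assoc]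
  simp_rw [hterm]
  rw [← Finset.sum_div, ← Complex.re_sum, sum_torusChar_mul_star_pairFieldAt_mulVec_dotProduct,
    show ((L : ℂ) ^ 2) = (((L : ℝ) ^ 2 : ℝ) : ℂ) by push_cast; rfl, Complex.re_ofReal_mul,
    mul_div_cancel_left₀ _ hL]

/-! ### Floors on the zero mode of the pair structure factor -/

/-- **Plain floor**: a floor `c L² ≤ Σ_x ‖P_x ψ‖²` on the on-site pair sum (the sum-rule constant, a
reduced-density-matrix quantity) and ceilings `S_ψ(m) ≤ B_m` at every `m ≠ 0` give
`c L² - Σ_{m ≠ 0} B_m ≤ S_ψ(0)`. CONDITIONAL as an instrument (the `B_m` are inputs); see the file header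
for the sizing at the cuprate anchors. [cite: KLS1988PRL, p. 2583] -/
theorem pairStructureFactor_zero_ge_of_onSite_floor_of_ceilings (ψ : Fock (Orb (FermionTorus 2 L)))
    {c : ℝ} (B : TorusSite 2 L → ℝ)
    (hfloor : c * (L : ℝ) ^ 2 ≤ ∑ x, (star (localPair g L x *ᵥ ψ) ⬝ᵥ (localPair g L x *ᵥ ψ)).re)
    (hceil : ∀ m : TorusSite 2 L, m ≠ 0 → pairStructureFactor g L ψ m ≤ B m) :
    c * (L : ℝ) ^ 2 - ∑ m ∈ (univ : Finset (TorusSite 2 L)).erase 0, B m ≤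
      pairStructureFactor g L ψ 0 :=
  sub_sum_erase_le_of_sumRule_of_ceilings (pairStructureFactor g L ψ) B 0
    (hfloor.trans (sum_pairStructureFactor g L ψ).symm.le) hceil

/-- **Plain floor in the long-range-order normalisation** of `hasPairFieldLRO_iff_liminf`:
`c - L⁻² Σ_{m ≠ 0} B_m ≤ L⁻⁴ Re⟨ψ, Δ_g† Δ_g ψ⟩`. [cite: KLS1988PRL, p. 2583] [cite: Scalapino1995, §2] -/
theorem pairFieldLRO_ge_of_onSite_floor_of_ceilings (ψ : Fock (Orb (FermionTorus 2 L)))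
    {c : ℝ} (B : TorusSite 2 L → ℝ)
    (hfloor : c * (L : ℝ) ^ 2 ≤ ∑ x, (star (localPair g L x *ᵥ ψ) ⬝ᵥ (localPair g L x *ᵥ ψ)).re)
    (hceil : ∀ m : TorusSite 2 L, m ≠ 0 → pairStructureFactor g L ψ m ≤ B m) :
    c - (∑ m ∈ (univ : Finset (TorusSite 2 L)).erase 0, B m) / (L : ℝ) ^ 2 ≤
      (expect ((pairField g L)ᴴ * pairField g L) ψ).re / (L : ℝ) ^ 4 := by
  have hL : (0 : ℝ) < (L : ℝ) ^ 2 := pow_pos (Nat.cast_pos.2 (Nat.pos_of_ne_zero (NeZero.ne L))) 2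
  have h := pairStructureFactor_zero_ge_of_onSite_floor_of_ceilings g L ψ B hfloor hceil
  rw [pairStructureFactor_zero] at h
  have h2 := div_le_div_of_nonneg_right h hL.le
  rw [sub_div, mul_div_cancel_right₀ _ hL.ne', div_div,
    show (L : ℝ) ^ 2 * (L : ℝ) ^ 2 = (L : ℝ) ^ 4 by ring] at h2
  exact h2

/-- **LP-dual floor with a certified window of pair correlations.** Data for one Fock vector `ψ`: a finite
window `W` of shifts with certified two-sided rows `|Re Σ_x ⟨P_x ψ, P_{x+z} ψ⟩ - c_z| ≤ ε_z` (`z ∈ W`) and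
ceilings `S_ψ(m) ≤ B_m` (`m ≠ 0`); certificate: real shift weights `κ_z` (the LP dual). Conclusion, with the
kernel `K(m) = Σ_{z ∈ W} κ_z Re χ_m(z)` (`K(0) = Σ_z κ_z`):
`Σ_{z ∈ W} (κ_z c_z - |κ_z| ε_z) - Σ_{m ≠ 0} K(m)⁺ B_m ≤ K(0) · S_ψ(0)`.
CONDITIONAL as an instrument (the `B_m` are inputs); calibration [float] in the file header.
[cite: KLS1988JSP, eqs. (2)-(3), (6)-(9)] -/
theorem kernel_pairStructureFactor_zero_floor (ψ : Fock (Orb (FermionTorus 2 L)))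
    (W : Finset (TorusSite 2 L)) (κ c ε : TorusSite 2 L → ℝ) (B : TorusSite 2 L → ℝ)
    (hrow : ∀ z ∈ W,
      |(∑ x, star (localPair g L x *ᵥ ψ) ⬝ᵥ (localPair g L (x + z) *ᵥ ψ)).re - c z| ≤ ε z)
    (hceil : ∀ m : TorusSite 2 L, m ≠ 0 → pairStructureFactor g L ψ m ≤ B m) :
    ∑ z ∈ W, (κ z * c z - |κ z| * ε z) -
        ∑ m ∈ (univ : Finset (TorusSite 2 L)).erase 0,
          max (∑ z ∈ W, κ z * (torusChar m z).re) 0 * B m ≤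
      (∑ z ∈ W, κ z) * pairStructureFactor g L ψ 0 := by
  have h := lpDual_kernel_floor W (fun z m => (torusChar m z).re) c ε κ (pairStructureFactor g L ψ) B 0
    (pairStructureFactor_nonneg g L ψ)
    (fun z hz => by rw [sum_re_torusChar_mul_pairStructureFactor]; exact hrow z hz) hceil
  simpa only [torusChar_zero_left, Complex.one_re, mul_one] using h

end PairField

/-! ### The thermodynamic-limit consumer -/

section ThermodynamicLimit

/-- **Pair-field long-range order from an eventual on-site floor and eventual `m ≠ 0` ceilings.** For a family
`ψ_L` of normalised `N_L`-particle torus states: if eventually (in the side `L + 1`) the on-site pair sum has a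
floor `c (L+1)² ≤ Σ_x ‖P_x ψ_{L+1}‖²`, the pair structure factor has ceilings `S(m) ≤ B_{L+1}(m)` at every
`m ≠ 0` whose sum is `≤ β (L+1)²`, and `β < c`, then `HasPairFieldLRO g N ψ` (the summit functional's order,
via `hasTorusLRO_of_eventually_le` and the a-priori bound `pairFieldCorr_succ_le`). CONDITIONAL as an
instrument — the ceilings are inputs; at the cuprate anchors the sizing of the file header applies
(`β < c` needs the summed relative slack of the ceilings below the condensate share, `≤ 3.7 %` there).
[cite: KLS1988PRL, p. 2583] [cite: Scalapino1995, §2 eq. (2.4)] -/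
theorem hasPairFieldLRO_of_eventually_onSite_floor_of_ceilings (g : Site 2 → ℝ) (N : ℕ → ℕ)
    (ψ : ∀ L, Fock (Orb (FermionTorus 2 L)))
    (hψ : ∀ L, IsNParticle (N L) (ψ L) ∧ star (ψ L) ⬝ᵥ ψ L = 1)
    (B : (L : ℕ) → TorusSite 2 L → ℝ) {c β : ℝ} (hβc : β < c)
    (hfloor : ∀ᶠ L : ℕ in atTop, c * ((L + 1 : ℕ) : ℝ) ^ 2 ≤
      ∑ x, (star (localPair g (L + 1) x *ᵥ ψ (L + 1)) ⬝ᵥ (localPair g (L + 1) x *ᵥ ψ (L + 1))).re)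
    (hceil : ∀ᶠ L : ℕ in atTop, ∀ m : TorusSite 2 (L + 1), m ≠ 0 →
      pairStructureFactor g (L + 1) (ψ (L + 1)) m ≤ B (L + 1) m)
    (htail : ∀ᶠ L : ℕ in atTop,
      ∑ m ∈ (univ : Finset (TorusSite 2 (L + 1))).erase 0, B (L + 1) m ≤ β * ((L + 1 : ℕ) : ℝ) ^ 2) :
    HasPairFieldLRO g N ψ := by
  refine ⟨hψ, hasTorusLRO_of_eventually_le (pairFieldCorr g ψ) (a := c - β)
    (b := (∑ e ∈ insert 0 unitSteps, ‖((g e / Real.sqrt 2 : ℝ) : ℂ)‖ * 2) ^ 2) (sub_pos.2 hβc) ?_ ?_⟩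
  · filter_upwards [hfloor, hceil, htail] with L hf hc ht
    rw [sum_pairFieldCorr_succ]
    have h := pairStructureFactor_zero_ge_of_onSite_floor_of_ceilings g (L + 1) (ψ (L + 1)) (B (L + 1))
      hf hc
    rw [pairStructureFactor_zero] at h
    have hL : (0 : ℝ) < ((L + 1 : ℕ) : ℝ) ^ 2 := by positivity
    rw [le_div_iff₀ hL] at h
    have key : (c - β) * ((L + 1 : ℕ) : ℝ) ^ (2 * 2) ≤
        (c * ((L + 1 : ℕ) : ℝ) ^ 2 - ∑ m ∈ (univ : Finset (TorusSite 2 (L + 1))).erase 0, B (L + 1) m) *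
          ((L + 1 : ℕ) : ℝ) ^ 2 := by
      rw [show ((L + 1 : ℕ) : ℝ) ^ (2 * 2) = ((L + 1 : ℕ) : ℝ) ^ 2 * ((L + 1 : ℕ) : ℝ) ^ 2 by ring,
        ← mul_assoc]
      exact mul_le_mul_of_nonneg_right (by linarith) hL.le
    exact key.trans h
  · filter_upwards with L
    exact fun x y => pairFieldCorr_succ_le g ψ L (hψ (L + 1)).2 x y

end ThermodynamicLimit

end Literature.MathematicalPhysics.QuantumLattice
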